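import Literature.Geometry.Lorentzian.CoordChartLorentz
import Literature.Geometry.Lorentzian.CoordChartSlicePrep
import Literature.Geometry.Lorentzian.CoordSlice
import Literature.Geometry.Lorentzian.DevelopmentGluingData
import Literature.Geometry.Lorentzian.ConnectionNaturality
import Literature.Geometry.Lorentzian.HypersurfaceRestriction
import Literature.Geometry.Manifold.ChartFromFunctions
import Literature.Geometry.Manifold.InverseFunctionTheorem
import HarnessLib

/-!
# Route SwallowTheDatum · item `SubdataDevelopmentsEmbed` (stmt-FinalStateConjecture-10053) —
# preparations for the restart of local uniqueness at a spacelike boundary point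
# (Sbierski 2016, §3.2, proof of Thm. 12)

First of five files (`…RestartPrep`, `…RestartChart`, `…RestartLU`, `…RestartSetup`, `…Restart`) formalising the
restart step of Sbierski's proof of Thm. 12 from local uniqueness (see `…Restart.lean` for the
overview). This file contains the chart-independent preparations:

* `exists_nhds_injOn_injective_mfderiv` — a smooth map with injective differential at a point is an
  injective immersion near it (inverse function theorem on manifolds);
* `exists_adapted_chart_ball` — a chart of the maximal atlas adapted to a function with nonzero
  differential, `(Φ q)⁰ = f q`, with ball-shaped target inside a prescribed open set
  (`Literature.Geometry.Manifold.exists_mem_maximalAtlas_apply_zero_eq`, Lee 2013, Thm. 5.12);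
* `isConnected_lens_opens`, `range_sliceEmbed_lens_eq` — the lens over a slice point of a
  ball-shaped chart target is connected and meets the slice exactly in the image of the half-radius
  ball (Hawking–Ellis 1973, §7.4, Fig. 48);
* `agree_of_commonDevelopment` — a map agreeing with the glueing map `ψ` of a common development
  `(U, ψ)` on `W ∩ U` is isometric and time-orientation preserving there (`ψ` is).

The chart-level lemmas (agreement of the two coordinate metrics, cone agreement, the spacelike
radius, the push-forward `ψ ∘ Φ⁻¹`) are in `…RestartChart.lean`.

Everything is proved; no definitions, no named facts.
-/

noncomputable section

open Bundle Set Function Filter TopologicalSpace Manifold Topology Metric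
open scoped Manifold ContDiff Topology

namespace Summit.FinalStateConjecture.FinalStateConjecture.Theorems

namespace SubdataDevelopmentsEmbed

open Literature.Geometry.Lorentzian

/-! ### Step 0: a neighbourhood on which the extension is an injective local diffeomorphism -/

/-- **A smooth map with injective differential at a point is an injective immersion near the
point** (inverse function theorem on manifolds,
`Literature.Geometry.Manifold.isLocalDiffeomorphAt_of_mfderiv`: the local diffeomorphism chart at
`p₀` is injective with invertible differentials on its source, on which it agrees with the map).
Sbierski 2016, §3.2, Lemma 14 ("a smooth diffeomorphism onto its image").
[cite: Sbierski2016AHP, §3.2, Lemma 14 (arXiv numbering)] -/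
theorem exists_nhds_injOn_injective_mfderiv {M₁ M₂ : Type*} [TopologicalSpace M₁]
    [ChartedSpace E4 M₁] [IsManifold (𝓡 4) ∞ M₁] [TopologicalSpace M₂] [ChartedSpace E4 M₂]
    [IsManifold (𝓡 4) ∞ M₂] {ψ : M₁ → M₂} {W : Set M₁} (hW : IsOpen W) {p₀ : M₁} (hp₀ : p₀ ∈ W)
    (hψ : ContMDiffOn (𝓡 4) (𝓡 4) ∞ ψ W) (hdψ : Injective (mfderiv (𝓡 4) (𝓡 4) ψ p₀)) :
    ∃ O : Set M₁, IsOpen O ∧ p₀ ∈ O ∧ O ⊆ W ∧ InjOn ψ O ∧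
      ∀ q ∈ O, Injective (mfderiv (𝓡 4) (𝓡 4) ψ q) := by
  obtain ⟨e, he⟩ := PseudoRiemannianMetric.isInvertible_mfderiv_of_injective
    (I := 𝓡 4) (I' := 𝓡 4) (Φ := ψ) rfl hdψ
  have hld : IsLocalDiffeomorphAt (𝓡 4) (𝓡 4) ∞ ψ p₀ :=
    Literature.Geometry.Manifold.isLocalDiffeomorphAt_of_mfderiv (by simp) hW hp₀ hψ e he.symm
  obtain ⟨Φ, hp₀Φ, heq⟩ := hld
  refine ⟨W ∩ Φ.source, hW.inter Φ.open_source, ⟨hp₀, hp₀Φ⟩, inter_subset_left, ?_, ?_⟩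
  · intro x hx y hy hxy
    have h1 : Φ x = Φ y := by rw [← heq hx.2, ← heq hy.2]; exact hxy
    exact Φ.injOn hx.2 hy.2 h1
  · intro q hq
    have hq' : IsLocalDiffeomorphAt (𝓡 4) (𝓡 4) ∞ ψ q := ⟨Φ, hq.2, heq⟩
    exact (hq'.mfderivToContinuousLinearEquiv (by simp)).injective

/-! ### Step 1: a chart adapted to the time function, with ball-shaped target -/

/-- **A chart of the maximal atlas adapted to a function with nonzero differential, with
ball-shaped target inside a prescribed open set.** For `f` smooth on an open `O ∋ p₀` with
`df_{p₀} ≠ 0` there is `Φ ∈ maximalAtlas` with `p₀ ∈ Φ.source ⊆ O`, `(Φ q)⁰ = f q` on `Φ.source`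
(`exists_mem_maximalAtlas_apply_zero_eq`, Lee 2013, Thm. 5.12), and `Φ.target` an open ball about
`Φ p₀` (restriction of the chart to the preimage of a ball, `restr_mem_maximalAtlas`).
[cite: LeeSmoothManifolds2013, Thm. 5.12] -/
theorem exists_adapted_chart_ball {M : Type*} [TopologicalSpace M] [ChartedSpace E4 M]
    [IsManifold (𝓡 4) ∞ M] {f : M → ℝ} {O : Set M} (hO : IsOpen O) {p₀ : M} (hp₀ : p₀ ∈ O)
    (hf : ContMDiffOn (𝓡 4) 𝓘(ℝ, ℝ) ∞ f O)
    (hdf : ∃ v : TangentSpace (𝓡 4) p₀, mfderiv (𝓡 4) 𝓘(ℝ, ℝ) f p₀ v ≠ 0) :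
    ∃ Φ ∈ IsManifold.maximalAtlas (𝓡 4) ∞ M, p₀ ∈ Φ.source ∧ Φ.source ⊆ O ∧
      (∀ q ∈ Φ.source, Φ q 0 = f q) ∧ ∃ r : ℝ, 0 < r ∧ Φ.target = ball (Φ p₀) r := by
  obtain ⟨-, hF, hℓ⟩ := hasFDerivAt_comp_chartAt_symm_of_contMDiffOn hO hp₀ hf
  set ℓ := fderiv ℝ (f ∘ (chartAt E4 p₀).symm) (chartAt E4 p₀ p₀) with hℓ_def
  have hℓ0 : ℓ ≠ 0 := by
    obtain ⟨v, hv⟩ := hdf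
    intro h
    apply hv
    rw [← hℓ v, h]
    rfl
  obtain ⟨Φ₀, hΦ₀, hp₀Φ₀, hsrc, hzero⟩ :=
    Literature.Geometry.Manifold.exists_mem_maximalAtlas_apply_zero_eq hO hf hp₀ ℓ hℓ0 hF
  -- a ball inside the target, and the restricted chart
  obtain ⟨r, hr, hball⟩ := Metric.isOpen_iff.1 Φ₀.open_target (Φ₀ p₀) (Φ₀.map_source hp₀Φ₀)
  set s : Set M := Φ₀.source ∩ Φ₀ ⁻¹' ball (Φ₀ p₀) r with hs
  have hs_open : IsOpen s := Φ₀.isOpen_inter_preimage isOpen_ball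
  set Φ := Φ₀.restr s with hΦ_def
  have hΦ : Φ ∈ IsManifold.maximalAtlas (𝓡 4) ∞ M := restr_mem_maximalAtlas _ hΦ₀ hs_open
  have hΦsrc : Φ.source = s := by
    rw [hΦ_def, Φ₀.restr_source' s hs_open, hs, ← inter_assoc, inter_self]
  have hcoe : ∀ q, Φ q = Φ₀ q := fun _ ↦ rfl
  have htgt : Φ.target = Φ₀.target ∩ Φ₀.symm ⁻¹' s := by
    rw [hΦ_def, OpenPartialHomeomorph.restr_target, hs_open.interior_eq]
  refine ⟨Φ, hΦ, ?_, ?_, ?_, r, hr, ?_⟩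
  · rw [hΦsrc, hs]
    exact ⟨hp₀Φ₀, mem_ball_self hr⟩
  · rw [hΦsrc, hs]
    exact fun q hq ↦ hsrc hq.1
  · intro q hq
    rw [hΦsrc, hs] at hq
    rw [hcoe]
    exact hzero q hq.1
  · rw [hcoe]
    ext x
    constructor
    · intro hx
      have hx' : x ∈ Φ₀.target ∧ Φ₀.symm x ∈ s := by
        rw [htgt] at hx
        exact hx
      have h2 := hx'.2.2
      rw [mem_preimage, Φ₀.right_inv hx'.1] at h2
      exact h2
    · intro hx
      rw [htgt]
      refine ⟨hball hx, Φ₀.map_target (hball hx), ?_⟩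
      rw [mem_preimage, Φ₀.right_inv (hball hx)]
      exact hx

/-! ### The lens over a slice point of a ball-shaped chart target -/

/-- **A lens over a slice point of a ball-shaped chart target is connected** (it is the preimage
under the inclusion of the star-shaped lens of `E4`, `CoordSlice.isConnected_lens`).
[cite: HawkingEllis1973CUP, §7.4, p. 234 and Fig. 48] -/
theorem isConnected_lens_opens {T : Opens E4} {x₀ : E4} {r : ℝ} (hT : (T : Set E4) = ball x₀ r)
    (hx₀0 : x₀ 0 = 0) {a : T} (ha : (a : E4) = x₀) {k ρ' : ℝ} (hk : 0 < k) (hρ' : 0 < ρ')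
    (hρ'r : ρ' ≤ r) (V : Opens T)
    (hV : ∀ x : T, x ∈ V ↔ ‖(x : E4) - a‖ < ρ' ∧
      |CoordSlice.dt (x : E4)| + k * ‖(x : E4) - a‖ < k * (ρ' / 2)) :
    IsConnected (V : Set T) := by
  have hK := CoordSlice.isConnected_lens (a := x₀) hx₀0 (k := k) hk.le hρ'
    (δ := k * (ρ' / 2)) (by positivity)
  have hKT : {x : E4 | ‖x - x₀‖ < ρ' ∧ |x 0| + k * ‖x - x₀‖ < k * (ρ' / 2)} ⊆
      range (Subtype.val : T → E4) := fun x hx ↦ by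
    rw [Subtype.range_coe]
    show x ∈ (T : Set E4)
    rw [hT, mem_ball, dist_eq_norm]; exact hx.1.trans_le hρ'r
  have hpre : (V : Set T) =
      Subtype.val ⁻¹' {x : E4 | ‖x - x₀‖ < ρ' ∧ |x 0| + k * ‖x - x₀‖ < k * (ρ' / 2)} := by
    ext y
    rw [ha] at hV
    exact hV y
  rw [hpre]
  exact hK.preimage_of_isOpenMap Subtype.val_injective T.isOpen.isOpenMap_subtype_val hKT

/-- **The trace of the lens on the slice is the image of the half-radius ball**: for the lens
`V = {‖x - a‖ < ρ' ∧ |x⁰| + k‖x - a‖ < kρ'/2}` over the slice point `a = (0, y₀)` and the ball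
`B = B(y₀, ρ'/2) ⊆ E3`, the points of `V` with `x⁰ = 0` are exactly the points `(0, y)`, `y ∈ B`
(`E4.norm_spatial_sub_lt_of_lens`, `E4.ofTimeSpace_mem_lens`). [cite: HawkingEllis1973CUP, §7.4, p. 234 and Fig. 48] -/
theorem range_sliceEmbed_lens_eq {T : Opens E4} {x₀ : E4} {a : T} (ha : (a : E4) = x₀)
    {k ρ' : ℝ} (hk : 0 < k) {B : Opens E3} (hmemB : ∀ y : E3, y ∈ B ↔ ‖y - E4.spatial x₀‖ < ρ' / 2)
    (hBT : ∀ y ∈ B, E4.ofTimeSpace 0 y ∈ T) (V : Opens T)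
    (hV : ∀ x : T, x ∈ V ↔ ‖(x : E4) - a‖ < ρ' ∧
      |CoordSlice.dt (x : E4)| + k * ‖(x : E4) - a‖ < k * (ρ' / 2))
    (hι : ∀ y : B, CoordSlice.sliceEmbed hBT y ∈ V) :
    range (fun y : B ↦ (⟨CoordSlice.sliceEmbed hBT y, hι y⟩ : V)) =
      Subtype.val ⁻¹' {x : T | CoordSlice.dt (x : E4) = 0} := by
  ext z
  constructor
  · rintro ⟨y, rfl⟩
    exact CoordSlice.dt_ofTimeSpace 0 (y : E3)
  · intro hz
    have hz0 : ((z : T) : E4) 0 = 0 := by rw [← CoordSlice.dt_apply]; exact hz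
    obtain ⟨-, h2⟩ := (hV z.1).1 z.2
    rw [CoordSlice.dt_apply, ha] at h2
    have hsp : ‖E4.spatial ((z : T) : E4) - E4.spatial x₀‖ < ρ' / 2 :=
      E4.norm_spatial_sub_lt_of_lens (a := x₀) hz0 hk h2
    refine ⟨⟨E4.spatial ((z : T) : E4), (hmemB _).2 hsp⟩, ?_⟩
    apply Subtype.ext
    apply Subtype.ext
    show E4.ofTimeSpace 0 (E4.spatial ((z : T) : E4)) = ((z : T) : E4)
    have h := E4.ofTimeSpace_time_spatial ((z : T) : E4)
    rw [E4.time_apply, hz0] at h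
    exact h


/-! ### A local extension of the glueing map is isometric where it agrees with it -/

/-- **A map agreeing with the glueing map on `W ∩ U` is isometric and time-orientation preserving
there.** For a common development `𝔠 = (U, ψ_U)` of `𝒟₁`, `𝒟₂`, an open `W` and a map `ψ` smooth
on `W` with `ψ = ψ_U` on `W ∩ U`: at every `q ∈ W ∩ U`, `ψ^* g₂ = g₁` and `dψ T₁` is future
directed (`ψ` and `ψ_U` agree near `q`, hence have the same differential; `ψ_U` is a
time-orientation preserving isometric immersion). [cite: Sbierski2016AHP, §2, Def. 2.4 and §3.2, Lemma 14] -/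
theorem agree_of_commonDevelopment {n : ℕ} {X : Type} [TopologicalSpace X]
    [ChartedSpace (EuclideanSpace ℝ (Fin n)) X] [IsManifold (𝓡 n) ∞ X] [ConnectedSpace X]
    {D : InitialDataSet (𝓡 n) X} {𝒟₁ 𝒟₂ : CauchyDevelopment D}
    (𝔠 : CauchyDevelopment.CommonDevelopment 𝒟₁ 𝒟₂) {W : Set 𝒟₁.carrier} (hW : IsOpen W)
    {ψ : 𝒟₁.carrier → 𝒟₂.carrier} (hψs : ContMDiffOn (𝓡 (n + 1)) (𝓡 (n + 1)) ∞ ψ W)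
    (hψU : ∀ (q : 𝒟₁.carrier) (hq : q ∈ 𝔠.opens), q ∈ W → ψ q = 𝔠.map ⟨q, hq⟩)
    {q : 𝒟₁.carrier} (hq : q ∈ 𝔠.opens) (hqW : q ∈ W) :
    pullbackBilin (I := 𝓡 (n + 1)) (I' := 𝓡 (n + 1)) ψ 𝒟₂.metric.val q = 𝒟₁.metric.val q ∧
      𝒟₂.timeOrientation.IsFutureDirected
        (mfderiv (𝓡 (n + 1)) (𝓡 (n + 1)) ψ q (𝒟₁.timeOrientation.vectorField q)) := by
  have hev : (ψ ∘ Subtype.val : 𝔠.opens → 𝒟₂.carrier) =ᶠ[𝓝 ⟨q, hq⟩] 𝔠.map := by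
    have h1 : ∀ᶠ y : 𝔠.opens in 𝓝 ⟨q, hq⟩, (y : 𝒟₁.carrier) ∈ W :=
      continuous_subtype_val.continuousAt.preimage_mem_nhds (hW.mem_nhds hqW)
    filter_upwards [h1] with y hy
    exact hψU y y.2 hy
  have hd : MDifferentiableAt (𝓡 (n + 1)) (𝓡 (n + 1)) ψ q :=
    ((hψs q hqW).contMDiffAt (hW.mem_nhds hqW)).mdifferentiableAt (by simp)
  have hmf : mfderiv (𝓡 (n + 1)) (𝓡 (n + 1)) (ψ ∘ Subtype.val : 𝔠.opens → 𝒟₂.carrier) ⟨q, hq⟩ =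
      mfderiv (𝓡 (n + 1)) (𝓡 (n + 1)) ψ q := mfderiv_comp_subtypeVal (y := (⟨q, hq⟩ : 𝔠.opens)) hd
  have hmf' : mfderiv (𝓡 (n + 1)) (𝓡 (n + 1)) (ψ ∘ Subtype.val : 𝔠.opens → 𝒟₂.carrier) ⟨q, hq⟩ =
      mfderiv (𝓡 (n + 1)) (𝓡 (n + 1)) 𝔠.map ⟨q, hq⟩ := hev.mfderiv_eq
  refine ⟨?_, ?_⟩
  · have hk := 𝔠.isIsometricImmersion.2 ⟨q, hq⟩
    ext v w
    have hk' := congrArg (fun b ↦ b v w) hk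
    simp only [pullbackBilin_apply] at hk' ⊢
    rw [← hmf', hmf, ← hψU q hq hqW] at hk'
    exact hk'
  · have hk := 𝔠.preservesTimeOrientation ⟨q, hq⟩
    rw [← hmf', hmf, ← hψU q hq hqW] at hk
    exact hk

end SubdataDevelopmentsEmbed

end Summit.FinalStateConjecture.FinalStateConjecture.Theorems

end
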